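import Mathlib
import Literature.Analysis.FluidPDE.Tao2016AveragedNS.BoundedEternalSolutions
import Summits.NavierStokesRegularity.NavierStokesRegularity.Theorems.TaoLadderRungTwoBreakNoSurvivingEternalViscBddOneWakeDyadicDSSConveyorGap

/-!
# Crux `TaoLadderRungTwoBreak.NoSurvivingEternalViscBddOne` (stmt-NavierStokesRegularity-20419) / ⟨20205⟩ `NoSurvivingDSSOne`, DYADIC
# MEMBER, DSS STRATUM: the energy–flux identity is EXACT on a DSS front (no tail hypothesis) — `∫_{(−∞,0)}Π_n = Λ^{-2(n+1)}v_{n+1}²/(1 − κ²/Λ²)`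
# — and the square-root OVERSHOOT CEILING `V_n(t) ≤ v_n·Λ/√(Λ² − κ²)`

MODEL lattice ODEs only (non-negative period-one DSS solutions `V_{k+1}(t) = κV_k(κt)`, `0 < κ < Λ`, of the Katz–Pavlović chain in Tao's
critical variables; the tree's single-profile `IsDSSWave ε₀ dyadicTable π T Φ`); nothing in this file is a statement about the Navier–Stokes
equations, and no stub, crux, rung or summit is proved by it (`--supports stmt-NavierStokesRegularity-20419`).  DEF-FREE; completes
identity (I2) of the hand's memo `W1-DSS-identities-memo-leafhand4-g24.md` on the DSS stratum:

* `flux_scaling_dss` — `∫_{(−∞,0)}Π_{k+1} = (κ²/Λ²)∫_{(−∞,0)}Π_k` (pointwise `Π_{k+1}(t) = (κ³/Λ²)Π_k(κt)` and the change of variables);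
  `flux_iterate_dss` — `∫Π_{n+N} = (κ²/Λ²)^N ∫Π_n`, hence `tendsto_flux_dss` — the lifetime flux through bond `n+N` tends to `0`:
  NO ENERGY ESCAPES TO INFINITY before the blow-up time on a sub-unitary DSS front;
* **`hasSum_strandedEnergy_dss`**, **`lifetimeFlux_eq_dss`** — therefore the tree's `hasSum_strandedEnergy` applies unconditionally:
  `Σ_{k>n}Λ^{-2k}v_k² = ∫_{(−∞,0)}Π_n = Λ^{-2(n+1)}v_{n+1}²/(1 − κ²/Λ²)` — in profile form `∫₀^∞ψ²(u)ψ(κu)du = κΛ/(2(Λ²−κ²))` exactly;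
* **`dss_overshoot_ceiling_sq`** — with `…DSSConveyorGap.energy_le_lifetimeFlux`: `V_n(t)² ≤ v_n²·Λ²/(Λ² − κ²)` for every `t < 0` — an
  absolute overshoot ceiling of size `≍ (log Λ)^{-1/2}` as the base tends to one (sharper than the `≍ 1/log Λ` ceiling of
  `…DSSConveyorGap`; the conveyor-gap consequence is the same inequality `(Λ²−κ√κ)² ≤ 4Λ²(Λ²−κ²)`);
* `dssWave_lifetimeFlux_eq`, `dssWave_overshoot_ceiling_sq` — BY NAME for the tree's admissible single-profile DSS waves of `dyadicTable`.

HONEST LABEL: elementary consequences of the hand's identity files; W1-dyadic, (ρ0), ⟨20419⟩, ⟨20205⟩ and every NS statement remain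
OPEN; rung 0.
-/

-- the summit and its single sub-problem share the name (CONVENTIONS §1)
set_option linter.dupNamespace false

namespace Summit.NavierStokesRegularity.NavierStokesRegularity.Theorems.NoSurvivingEternalViscBddOne.DSSExactEnergy

open Filter Topology Set MeasureTheory Finset
open Literature.Analysis.FluidPDE.TaoCascade
open Summit.NavierStokesRegularity.NavierStokesRegularity.Theorems.NoSurvivingEternalViscBddOne
open Summit.NavierStokesRegularity.NavierStokesRegularity.Theorems.NoSurvivingEternalViscBddOne.WakeCriterion
  (dyadic_crit_hasDerivAt dyadic_crit_tendsto dyadic_classical_hyp_nonneg)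

variable {ε₀ κ : ℝ} {V : ℤ → ℝ → ℝ} {v : ℤ → ℝ} {P : ℤ → ℝ → ℝ}

/-! ## Flux scaling on a DSS front: no energy escapes to infinity -/

/-- Pointwise flux scaling: `Π_{k+1}(t) = (κ³/Λ²)·Π_k(κt)` on `t < 0`. [elementary] -/
theorem flux_pointwise_dss (hε : 0 < ε₀)
    (hdss : ∀ (n : ℤ) (t : ℝ), t < 0 → V (n + 1) t = κ * V n (κ * t))
    (hP : ∀ k t, P k t = 2 * (((bigLam ε₀ ^ k)⁻¹) ^ 2 * (bigLam ε₀)⁻¹) * (V k t ^ 2 * V (k + 1) t))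
    (hκ : 0 < κ) (k : ℤ) {t : ℝ} (ht : t < 0) :
    P (k + 1) t = κ ^ 3 / bigLam ε₀ ^ 2 * P k (κ * t) := by
  have hΛ : 0 < bigLam ε₀ := bigLam_pos (by linarith)
  have hΛne : bigLam ε₀ ≠ 0 := hΛ.ne'
  have h1 : V (k + 1) t = κ * V k (κ * t) := hdss k t ht
  have h2 : V (k + 1 + 1) t = κ * V (k + 1) (κ * t) := hdss (k + 1) t ht
  rw [hP (k + 1) t, hP k (κ * t), h2, h1, zpow_add_one₀ hΛne k]
  have hk : bigLam ε₀ ^ k ≠ 0 := zpow_ne_zero k hΛne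
  field_simp

/-- **Flux scaling**: `∫_{(−∞,0)}Π_{k+1} = (κ²/Λ²)·∫_{(−∞,0)}Π_k`. [elementary] -/
theorem flux_scaling_dss (hε : 0 < ε₀) (hκ : 0 < κ)
    (hdss : ∀ (n : ℤ) (t : ℝ), t < 0 → V (n + 1) t = κ * V n (κ * t))
    (hP : ∀ k t, P k t = 2 * (((bigLam ε₀ ^ k)⁻¹) ^ 2 * (bigLam ε₀)⁻¹) * (V k t ^ 2 * V (k + 1) t)) (k : ℤ) :
    ∫ t in Iio 0, P (k + 1) t = κ ^ 2 / bigLam ε₀ ^ 2 * ∫ t in Iio 0, P k t := by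
  have h1 : ∫ t in Iio 0, P (k + 1) t = ∫ t in Iio 0, κ ^ 3 / bigLam ε₀ ^ 2 * P k (κ * t) :=
    setIntegral_congr_fun measurableSet_Iio fun t ht => flux_pointwise_dss hε hdss hP hκ k ht
  rw [h1, integral_const_mul, DSSOvershootFloor.setIntegral_Iio_comp_mul (P k) 0 hκ, mul_zero]
  field_simp

/-- **Iterated flux scaling**: `∫Π_{n+N} = (κ²/Λ²)^N ∫Π_n`. [elementary] -/
theorem flux_iterate_dss (hε : 0 < ε₀) (hκ : 0 < κ)
    (hdss : ∀ (n : ℤ) (t : ℝ), t < 0 → V (n + 1) t = κ * V n (κ * t))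
    (hP : ∀ k t, P k t = 2 * (((bigLam ε₀ ^ k)⁻¹) ^ 2 * (bigLam ε₀)⁻¹) * (V k t ^ 2 * V (k + 1) t)) (n : ℤ) (N : ℕ) :
    ∫ t in Iio 0, P (n + N) t = (κ ^ 2 / bigLam ε₀ ^ 2) ^ N * ∫ t in Iio 0, P n t := by
  induction N with
  | zero => simp
  | succ m ih =>
    have e : n + ((m + 1 : ℕ) : ℤ) = n + (m : ℤ) + 1 := by push_cast; ring
    rw [e, flux_scaling_dss hε hκ hdss hP (n + m), ih, pow_succ]
    ring

/-- **No energy escapes to infinity on a sub-unitary DSS front**: the lifetime flux through bond `n+N` tends to `0` as `N → ∞`.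
[cite: Tao2016AveragedNS, §1.2, §4 Lemma 4.1 (4.8)–(4.10), §6.4; elementary] -/
theorem tendsto_flux_dss (hε : 0 < ε₀) (hκ : 0 < κ) (hκΛ : κ < bigLam ε₀)
    (hdss : ∀ (n : ℤ) (t : ℝ), t < 0 → V (n + 1) t = κ * V n (κ * t))
    (hP : ∀ k t, P k t = 2 * (((bigLam ε₀ ^ k)⁻¹) ^ 2 * (bigLam ε₀)⁻¹) * (V k t ^ 2 * V (k + 1) t)) (n : ℤ) :
    Tendsto (fun N : ℕ => ∫ t in Iio 0, P (n + N) t) atTop (𝓝 0) := by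
  have hΛ : 0 < bigLam ε₀ := bigLam_pos (by linarith)
  have hr0 : 0 ≤ κ ^ 2 / bigLam ε₀ ^ 2 := div_nonneg (sq_nonneg _) (sq_nonneg _)
  have hr1 : κ ^ 2 / bigLam ε₀ ^ 2 < 1 := by
    rw [div_lt_one (pow_pos hΛ 2)]; exact pow_lt_pow_left₀ hκΛ hκ.le two_ne_zero
  have h := (tendsto_pow_atTop_nhds_zero_of_lt_one hr0 hr1).mul_const (∫ t in Iio 0, P n t)
  rw [zero_mul] at h
  refine h.congr fun N => ?_
  exact (flux_iterate_dss hε hκ hdss hP n N).symm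

/-! ## The exact energy–flux identity on a DSS front -/

/-- **Exact (I2) on a DSS front**: `Σ_{j≥0} Λ^{-2(n+1+j)} v_{n+1+j}² = ∫_{(−∞,0)} Π_n` (the tree's `hasSum_strandedEnergy`, its tail hypothesis
discharged by `tendsto_flux_dss`).  [cite: Tao2016AveragedNS, §1.2, §4 Lemma 4.1 (4.8)–(4.10), §6.4; elementary] -/
theorem hasSum_strandedEnergy_dss (hε : 0 < ε₀) (hκ : 0 < κ) (hκΛ : κ < bigLam ε₀)
    (hV : ∀ (n : ℤ) (t : ℝ), t < 0 →
      HasDerivAt (V n) (bigLam ε₀ * V (n - 1) t ^ 2 - (bigLam ε₀)⁻¹ * (V n t * V (n + 1) t)) t)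
    (hdss : ∀ (n : ℤ) (t : ℝ), t < 0 → V (n + 1) t = κ * V n (κ * t))
    (hP : ∀ k t, P k t = 2 * (((bigLam ε₀ ^ k)⁻¹) ^ 2 * (bigLam ε₀)⁻¹) * (V k t ^ 2 * V (k + 1) t))
    (hv : ∀ n : ℤ, Tendsto (V n) (𝓝[<] 0) (𝓝 (v n)))
    (hpast : ∀ k : ℤ, Tendsto (V k) atBot (𝓝 0))
    (hPint : ∀ k : ℤ, IntegrableOn (P k) (Iic 0)) (n : ℤ) :
    HasSum (fun j : ℕ => ((bigLam ε₀ ^ (n + 1 + j))⁻¹) ^ 2 * v (n + 1 + j) ^ 2) (∫ t in Iio 0, P n t) :=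
  EnergyFluxIdentity.hasSum_strandedEnergy hε hV hP hv hpast hPint n (tendsto_flux_dss hε hκ hκΛ hdss hP n)

/-- **The lifetime flux through bond `n` of a DSS front, in closed form**: `∫_{(−∞,0)} Π_n = Λ^{-2(n+1)} v_{n+1}² / (1 − κ²/Λ²)`.  In profile
form (`V_k(t) = κ^kψ(κ^k|t|)`, `ψ(0⁺) = 1`): `∫₀^∞ψ(u)²ψ(κu)du = κΛ/(2(Λ² − κ²))`.
[cite: Tao2016AveragedNS, §1.2, §4 Lemma 4.1 (4.8)–(4.10), §6.4; elementary] -/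
theorem lifetimeFlux_eq_dss (hε : 0 < ε₀) (hκ : 0 < κ) (hκΛ : κ < bigLam ε₀)
    (hV : ∀ (n : ℤ) (t : ℝ), t < 0 →
      HasDerivAt (V n) (bigLam ε₀ * V (n - 1) t ^ 2 - (bigLam ε₀)⁻¹ * (V n t * V (n + 1) t)) t)
    (hdss : ∀ (n : ℤ) (t : ℝ), t < 0 → V (n + 1) t = κ * V n (κ * t))
    (hP : ∀ k t, P k t = 2 * (((bigLam ε₀ ^ k)⁻¹) ^ 2 * (bigLam ε₀)⁻¹) * (V k t ^ 2 * V (k + 1) t))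
    (hv : ∀ n : ℤ, Tendsto (V n) (𝓝[<] 0) (𝓝 (v n)))
    (hpast : ∀ k : ℤ, Tendsto (V k) atBot (𝓝 0))
    (hPint : ∀ k : ℤ, IntegrableOn (P k) (Iic 0)) (n : ℤ) :
    ∫ t in Iio 0, P n t = ((bigLam ε₀ ^ (n + 1))⁻¹) ^ 2 * v (n + 1) ^ 2 / (1 - κ ^ 2 / bigLam ε₀ ^ 2) :=
  (hasSum_strandedEnergy_dss hε hκ hκΛ hV hdss hP hv hpast hPint n).unique
    (DSSOvershootFloor.strandedEnergy_dss_hasSum hε hκ hκΛ hdss hv (n + 1))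

/-! ## The square-root overshoot ceiling -/

/-- **OVERSHOOT CEILING (square-root form).**  On a non-negative sub-unitary DSS front born at rest with lifetime-integrable fluxes:
`V_n(t)² ≤ v_n² · Λ²/(Λ² − κ²)` for every `t < 0` (shell energy ≤ lifetime flux into the shell = stranded energy from the shell upward).
[cite: Tao2016AveragedNS, §1.2, §4 Lemma 4.1 (4.8)–(4.10), §6.4; elementary] -/
theorem dss_overshoot_ceiling_sq (hε : 0 < ε₀) (hκ : 0 < κ) (hκΛ : κ < bigLam ε₀)
    (hV : ∀ (n : ℤ) (t : ℝ), t < 0 →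
      HasDerivAt (V n) (bigLam ε₀ * V (n - 1) t ^ 2 - (bigLam ε₀)⁻¹ * (V n t * V (n + 1) t)) t)
    (hpos : ∀ (n : ℤ) (t : ℝ), t < 0 → 0 ≤ V n t)
    (hdss : ∀ (n : ℤ) (t : ℝ), t < 0 → V (n + 1) t = κ * V n (κ * t))
    (hP : ∀ k t, P k t = 2 * (((bigLam ε₀ ^ k)⁻¹) ^ 2 * (bigLam ε₀)⁻¹) * (V k t ^ 2 * V (k + 1) t))
    (hv : ∀ n : ℤ, Tendsto (V n) (𝓝[<] 0) (𝓝 (v n)))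
    (hpast : ∀ k : ℤ, Tendsto (V k) atBot (𝓝 0))
    (hPint : ∀ k : ℤ, IntegrableOn (P k) (Iic 0)) (n : ℤ) {t : ℝ} (ht : t < 0) :
    V n t ^ 2 ≤ v n ^ 2 * (bigLam ε₀ ^ 2 / (bigLam ε₀ ^ 2 - κ ^ 2)) := by
  have hΛ : 0 < bigLam ε₀ := bigLam_pos (by linarith)
  have hκ2 : κ ^ 2 < bigLam ε₀ ^ 2 := pow_lt_pow_left₀ hκΛ hκ.le two_ne_zero
  have h1 := DSSConveyorGap.energy_le_lifetimeFlux hε hV hpos hP hpast hPint n ht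
  have h2 := lifetimeFlux_eq_dss hε hκ hκΛ hV hdss hP hv hpast hPint (n - 1)
  rw [sub_add_cancel] at h2
  rw [h2] at h1
  have hw : 0 < ((bigLam ε₀ ^ n)⁻¹) ^ 2 := by positivity
  have hden : 0 < 1 - κ ^ 2 / bigLam ε₀ ^ 2 := by
    rw [sub_pos, div_lt_one (pow_pos hΛ 2)]; exact hκ2
  have h3 : ((bigLam ε₀ ^ n)⁻¹) ^ 2 * V n t ^ 2 ≤ ((bigLam ε₀ ^ n)⁻¹) ^ 2 * (v n ^ 2 / (1 - κ ^ 2 / bigLam ε₀ ^ 2)) := by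
    rw [mul_div_assoc] at h1; exact h1
  have h4 : V n t ^ 2 ≤ v n ^ 2 / (1 - κ ^ 2 / bigLam ε₀ ^ 2) := le_of_mul_le_mul_left h3 hw
  have e : v n ^ 2 / (1 - κ ^ 2 / bigLam ε₀ ^ 2) = v n ^ 2 * (bigLam ε₀ ^ 2 / (bigLam ε₀ ^ 2 - κ ^ 2)) := by
    have : bigLam ε₀ ^ 2 - κ ^ 2 ≠ 0 := by linarith
    field_simp
  rw [e] at h4
  exact h4

/-- Square-root form: `V_n(t) ≤ v_n · Λ/√(Λ² − κ²)`. [elementary] -/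
theorem dss_overshoot_ceiling_sqrt (hε : 0 < ε₀) (hκ : 0 < κ) (hκΛ : κ < bigLam ε₀)
    (hV : ∀ (n : ℤ) (t : ℝ), t < 0 →
      HasDerivAt (V n) (bigLam ε₀ * V (n - 1) t ^ 2 - (bigLam ε₀)⁻¹ * (V n t * V (n + 1) t)) t)
    (hpos : ∀ (n : ℤ) (t : ℝ), t < 0 → 0 ≤ V n t)
    (hdss : ∀ (n : ℤ) (t : ℝ), t < 0 → V (n + 1) t = κ * V n (κ * t))
    (hP : ∀ k t, P k t = 2 * (((bigLam ε₀ ^ k)⁻¹) ^ 2 * (bigLam ε₀)⁻¹) * (V k t ^ 2 * V (k + 1) t))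
    (hv : ∀ n : ℤ, Tendsto (V n) (𝓝[<] 0) (𝓝 (v n)))
    (hpast : ∀ k : ℤ, Tendsto (V k) atBot (𝓝 0))
    (hPint : ∀ k : ℤ, IntegrableOn (P k) (Iic 0)) (n : ℤ) {t : ℝ} (ht : t < 0) :
    V n t ≤ v n * (bigLam ε₀ / Real.sqrt (bigLam ε₀ ^ 2 - κ ^ 2)) := by
  have hΛ : 0 < bigLam ε₀ := bigLam_pos (by linarith)
  have hκ2 : κ ^ 2 < bigLam ε₀ ^ 2 := pow_lt_pow_left₀ hκΛ hκ.le two_ne_zero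
  have hgap : 0 < bigLam ε₀ ^ 2 - κ ^ 2 := by linarith
  have hvn : 0 ≤ v n := ge_of_tendsto (hv n) (eventually_nhdsWithin_of_forall fun t ht => hpos n t ht)
  have h := dss_overshoot_ceiling_sq hε hκ hκΛ hV hpos hdss hP hv hpast hPint n ht
  have hs : Real.sqrt (bigLam ε₀ ^ 2 - κ ^ 2) ^ 2 = bigLam ε₀ ^ 2 - κ ^ 2 := Real.sq_sqrt hgap.le
  have hspos : 0 < Real.sqrt (bigLam ε₀ ^ 2 - κ ^ 2) := Real.sqrt_pos.2 hgap
  have e : v n ^ 2 * (bigLam ε₀ ^ 2 / (bigLam ε₀ ^ 2 - κ ^ 2)) = (v n * (bigLam ε₀ / Real.sqrt (bigLam ε₀ ^ 2 - κ ^ 2))) ^ 2 := by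
    rw [mul_pow, div_pow, hs]
  rw [e] at h
  have hnn : 0 ≤ v n * (bigLam ε₀ / Real.sqrt (bigLam ε₀ ^ 2 - κ ^ 2)) := mul_nonneg hvn (div_nonneg hΛ.le hspos.le)
  exact (pow_le_pow_iff_left₀ (hpos n t ht) hnn two_ne_zero).1 h

/-! ## By name: the tree's single-profile DSS waves of the dyadic member -/

section DSS

variable {perm : Equiv.Perm (Fin 1)} {T : ℝ} {Φ : Fin 1 → ℝ → Em 4} {r₀ : Fin 1}

/-- **Exact lifetime flux of an admissible single-profile DSS wave of the dyadic member** (`κ = e^{T}`, `dssMu ε₀ T < 1`):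
`∫_{(−∞,0)} 2Λ^{-2n-1}V_n²V_{n+1} = Λ^{-2(n+1)}(r_{n+1})₀²/(1 − e^{2T}/Λ²)`.
[cite: Tao2016AveragedNS, §1.2, §4 Lemma 4.1 (4.8)–(4.10), §6.4; elementary] -/
theorem dssWave_lifetimeFlux_eq (hε : 0 < ε₀) (hΦ : IsDSSWave ε₀ dyadicTable perm T Φ) (hμ : dssMu ε₀ T < 1)
    {r : ℤ → Em 4} (hr : ∀ k : ℤ, Tendsto (fun σ : ℝ => Real.exp σ • dssEmbed perm T Φ r₀ k σ) atTop (𝓝 (r k))) (n : ℤ) :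
    ∫ t in Iio 0, 2 * (((bigLam ε₀ ^ n)⁻¹) ^ 2 * (bigLam ε₀)⁻¹) *
        (((-t)⁻¹ * (dssEmbed perm T Φ r₀ n (-Real.log (-t))) 0) ^ 2 *
          ((-t)⁻¹ * (dssEmbed perm T Φ r₀ (n + 1) (-Real.log (-t))) 0))
      = ((bigLam ε₀ ^ (n + 1))⁻¹) ^ 2 * (r (n + 1) 0) ^ 2 / (1 - Real.exp T ^ 2 / bigLam ε₀ ^ 2) := by
  have hW : IsEternal ε₀ dyadicTable (dssEmbed perm T Φ r₀) := hΦ.isEternal_dssEmbed r₀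
  exact lifetimeFlux_eq_dss
    (V := fun (k : ℤ) (s : ℝ) => (-s)⁻¹ * (dssEmbed perm T Φ r₀ k (-Real.log (-s))) 0)
    (v := fun k => r k 0)
    (P := fun (k : ℤ) (s : ℝ) => 2 * (((bigLam ε₀ ^ k)⁻¹) ^ 2 * (bigLam ε₀)⁻¹) *
      (((-s)⁻¹ * (dssEmbed perm T Φ r₀ k (-Real.log (-s))) 0) ^ 2 *
        ((-s)⁻¹ * (dssEmbed perm T Φ r₀ (k + 1) (-Real.log (-s))) 0)))
    hε (Real.exp_pos T) (DSSFrontOvershoot.exp_lt_bigLam_of_dssMu_lt_one hε hμ)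
    (fun k t ht => dyadic_crit_hasDerivAt hW k ht) (fun k t ht => DSSFrontOvershoot.crit_dss T Φ perm r₀ k ht)
    (fun k t => rfl) (fun k => dyadic_crit_tendsto hr k) (fun k => DSSFrontOvershoot.crit_tendsto_atBot hε hW k)
    (fun k => DSSFrontOvershoot.crit_integrableOn_flux hε hW k) n

/-- **Square-root overshoot ceiling of an admissible single-profile DSS wave of the dyadic member**: with `κ = e^{T}` and
`dssMu ε₀ T < 1`, every critical shell obeys `V_n(t) ≤ (r_n)₀ · Λ/√(Λ² − e^{2T})` for all `t < 0`.
[cite: Tao2016AveragedNS, §1.2, §4 Lemma 4.1 (4.8)–(4.10), §6.4; elementary] -/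
theorem dssWave_overshoot_ceiling_sqrt (hε : 0 < ε₀) (hΦ : IsDSSWave ε₀ dyadicTable perm T Φ) (hμ : dssMu ε₀ T < 1)
    {r : ℤ → Em 4} (hr : ∀ k : ℤ, Tendsto (fun σ : ℝ => Real.exp σ • dssEmbed perm T Φ r₀ k σ) atTop (𝓝 (r k)))
    (n : ℤ) {t : ℝ} (ht : t < 0) :
    (-t)⁻¹ * (dssEmbed perm T Φ r₀ n (-Real.log (-t))) 0
      ≤ r n 0 * (bigLam ε₀ / Real.sqrt (bigLam ε₀ ^ 2 - Real.exp T ^ 2)) := by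
  have hW : IsEternal ε₀ dyadicTable (dssEmbed perm T Φ r₀) := hΦ.isEternal_dssEmbed r₀
  obtain ⟨hpos, -⟩ := dyadic_classical_hyp_nonneg hε hW
  exact dss_overshoot_ceiling_sqrt
    (V := fun (k : ℤ) (s : ℝ) => (-s)⁻¹ * (dssEmbed perm T Φ r₀ k (-Real.log (-s))) 0)
    (v := fun k => r k 0)
    (P := fun (k : ℤ) (s : ℝ) => 2 * (((bigLam ε₀ ^ k)⁻¹) ^ 2 * (bigLam ε₀)⁻¹) *
      (((-s)⁻¹ * (dssEmbed perm T Φ r₀ k (-Real.log (-s))) 0) ^ 2 *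
        ((-s)⁻¹ * (dssEmbed perm T Φ r₀ (k + 1) (-Real.log (-s))) 0)))
    hε (Real.exp_pos T) (DSSFrontOvershoot.exp_lt_bigLam_of_dssMu_lt_one hε hμ)
    (fun k t ht => dyadic_crit_hasDerivAt hW k ht) hpos (fun k t ht => DSSFrontOvershoot.crit_dss T Φ perm r₀ k ht)
    (fun k t => rfl) (fun k => dyadic_crit_tendsto hr k) (fun k => DSSFrontOvershoot.crit_tendsto_atBot hε hW k)
    (fun k => DSSFrontOvershoot.crit_integrableOn_flux hε hW k) n ht

end DSS

end Summit.NavierStokesRegularity.NavierStokesRegularity.Theorems.NoSurvivingEternalViscBddOne.DSSExactEnergy
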